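import Mathlib
import Summits.AtomisticToContinuum.HydrodynamicLimit.Theorems.ImplosionDichotomyDenseExcursionPackingAnalyticStiffeningAnalytic

/-!
# Cauchy's estimate for the jet of the stiffening law, and the profile as a regular pair (closure glue)
# (crux `DenseExcursion`, stmt-AtomisticToContinuum-12586, line `sonic-cavity-renewal` v7, stub `stub_analyticPackingImplosion`)

Helper file (`--supports stmt-AtomisticToContinuum-12586`, line lead a2, wave-3 worker D; glue for the closure step of the
W6 report §4). Two hypotheses of the majorant bookkeeping (`packingSources_bound`, `majorant_shift`) that are not yet in the
tree as named facts:

* `analyticAt_jet_bound`: a function real-analytic at `0` has a GEOMETRIC jet, `|f⁽ʲ⁾(0)/j!| ≤ M βʲ` (Cauchy's estimate: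
  `f⁽ʲ⁾(0)/j! = p.coeff j` and `‖p j‖ rʲ ≤ C` inside the radius of convergence);
* `stiffening_jet_bound` (REGISTERED helper): hence the jet `m_j` of `M = stiffening F`, `F` analytic on `(−η₀, η₀)`, obeys
  `|m_j| ≤ M βʲ` — the hypothesis `∀ j, |m j| ≤ M * β ^ j` of `majorant_shift`;
* `isRegularPair_profile`: the profile `(W, S)` of `IsMonatomicProfile` is itself a regular pair (order `0` of the induction
  in `packingSources_regular`).

NOT here: norms or `Γ`.
-/

noncomputable section

open Set Filter
open scoped Topology ContDiff NNReal ENNReal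

namespace Summit.AtomisticToContinuum.HydrodynamicLimit.Theorems.PackingAnalyticImplosion

open Literature.MathematicalPhysics.KineticTheory (V3)
open Summit.AtomisticToContinuum.HydrodynamicLimit.Theorems.R2OneModeTwoConditions

/-- **Cauchy's estimate for the jet**: if `f` is analytic at `0` then `|f⁽ʲ⁾(0)/j!| ≤ M βʲ` for some `M, β ≥ 0`.
[folklore] -/
theorem analyticAt_jet_bound {f : ℝ → ℝ} (hf : AnalyticAt ℝ f 0) :
    ∃ M β : ℝ, 0 ≤ M ∧ 0 ≤ β ∧ ∀ j : ℕ, |iteratedDeriv j f 0 / (j.factorial : ℝ)| ≤ M * β ^ j := by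
  obtain ⟨p, r, hp⟩ := hf
  -- a positive radius strictly inside the ball of convergence
  obtain ⟨r', hr'0, hr'r⟩ := ENNReal.lt_iff_exists_nnreal_btwn.mp hp.r_pos
  have hr'0' : (0 : ℝ≥0) < r' := by exact_mod_cast hr'0
  have hlt : (r' : ℝ≥0∞) < p.radius := lt_of_lt_of_le hr'r hp.r_le
  obtain ⟨C, hCpos, hC⟩ := p.norm_mul_pow_le_of_lt_radius hlt
  have hC0 : 0 ≤ C := hCpos.le
  refine ⟨C, (r' : ℝ)⁻¹, hC0, by positivity, fun j => ?_⟩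
  -- `f⁽ʲ⁾(0)/j! = p.coeff j`
  have hfs := hp.factorial_smul 1 j
  rw [← iteratedDeriv_eq_iteratedFDeriv] at hfs
  have hc : p j (fun _ => (1 : ℝ)) = p.coeff j := by
    rw [FormalMultilinearSeries.apply_eq_pow_smul_coeff, one_pow, one_smul]
  rw [hc, nsmul_eq_mul] at hfs
  have hj0 : (j.factorial : ℝ) ≠ 0 := by positivity
  have hcoeff : iteratedDeriv j f 0 / (j.factorial : ℝ) = p.coeff j := by
    rw [← hfs]; field_simp
  rw [hcoeff, ← Real.norm_eq_abs, ← FormalMultilinearSeries.norm_apply_eq_norm_coef]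
  -- `‖p j‖ r'^j ≤ C`
  have h := hC j
  have hrpos : (0 : ℝ) < (r' : ℝ) ^ j := pow_pos (by exact_mod_cast hr'0') j
  rw [inv_pow, ← div_eq_mul_inv, le_div_iff₀ hrpos]
  exact h

/-- **THE JET OF THE STIFFENING LAW IS GEOMETRIC** (registered helper `stiffening_jet_bound` of
`stub_analyticPackingImplosion`): for an excess free energy `F` analytic on `(−η₀, η₀)` with `F 0 = 0`, the Taylor
coefficients `m_j = M⁽ʲ⁾(0)/j!` of `M = stiffening F` satisfy `|m_j| ≤ M₀ βʲ`. [folklore] -/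
theorem stiffening_jet_bound : ∀ (F : ℝ → ℝ) (η₀ : ℝ), 0 < η₀ → AnalyticOnNhd ℝ F (Set.Ioo (-η₀) η₀) → F 0 = 0 → ∃ M₀ β : ℝ, 0 ≤ M₀ ∧ 0 ≤ β ∧ ∀ j : ℕ, |iteratedDeriv j (stiffening F) 0 / (j.factorial : ℝ)| ≤ M₀ * β ^ j := by
  intro F η₀ hη₀ hF hF0
  exact analyticAt_jet_bound (stiffening_analyticAt_zero hη₀ hF hF0).1

/-- The profile `(W, S)` of `IsMonatomicProfile` is a regular pair (coerced), the order-`0` input of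
`packingSources_regular`. [folklore] -/
theorem isRegularPair_profile {r : ℝ} {W S : ℝ → ℝ} (hP : IsMonatomicProfile r W S) :
    IsRegularPair (fun x => (W x : ℂ)) (fun x => (S x : ℂ)) := by
  obtain ⟨-, -, hW, hS, -, -, ⟨F, G, hF, hG, -, hFG⟩, -, -⟩ := hP
  refine ⟨Complex.ofRealCLM.contDiff.comp hW, Complex.ofRealCLM.contDiff.comp hS, F, fun _ => 0, G, fun _ => 0, hF,
    contDiff_const, hG, contDiff_const, fun y hy => ?_⟩
  obtain ⟨h1, h2⟩ := hFG y hy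
  refine ⟨?_, ?_, ?_, ?_⟩
  · rw [Complex.ofReal_re]; exact h1
  · rw [Complex.ofReal_im, zero_smul]
  · rw [Complex.ofReal_re]; exact h2
  · rw [Complex.ofReal_im, mul_zero]

end Summit.AtomisticToContinuum.HydrodynamicLimit.Theorems.PackingAnalyticImplosion

end
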